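import Summits.AnomalousDissipation.AnomalousDissipation.Theorems.SawtoothPulseCascadeK1LocalisedCascadeTwoToothAnnulusMass
import Summits.AnomalousDissipation.AnomalousDissipation.Theorems.SawtoothPulseCascadeK1LocalisedCascadeVFibreParity
import Summits.AnomalousDissipation.AnomalousDissipation.Theorems.SawtoothPulseCascadeK1LocalisedCascadeHalfStepV

/-!
# K1loc explicit start, phase 1: V-TWIST WINDOW MASSES PER BLOCK, THE LEVEL WEIGHTS AND THE CLASS BOUND `Γ` («VTwistMass»)

Helper file of the prover lane on the crux `K1LocalisedCascade` (stmt-AnomalousDissipation-19491), route `SawtoothPulseCascade`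
(arbiter A24-6 steps (3)–(5); V-side input `hΓ` of `…VOJunkFrame.vo_junk_le_of_fibre_certs`).
* `vtwist_window_mass_le`: for a fibre `N_a ≤ |n| ≤ N_b` (`120 ≤ N_a`), a source `p` of the tube `S_n` and the fibre window `|m| ≤ W(n)`,
  the exact two-tooth chirp of lobe `8n` has `Σ_{|m|≤W(n)} ‖ĝ₀(m−p)‖² ≤ 2·0.101322·(s_a + s_b)²` whenever `4K < 8N_a`, the shifted window fits
  in `|m′| ≤ 4K−2`, and `1/(8N_a−4K) − 1/(8N_a) ≤ s_a²`, `1/(8N_a) − 1/(8N_a+4K) ≤ s_b²` (parity, then `…TwoToothAnnulusMass` on both sides with the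
  lobe parameter `c = N_a`);
* `phiV_antitone`: the explicit majorant `φ(x) = [x < 200]·0.0396607/(x − 108.5) + [x ≥ 200]·0.0768758/(x − 22)` is antitone on `x ≥ 120`;
* `card_tube_class_le`: in one residue class `p ≡ r (mod 4)` at most `2(⌊D/16⌋+1)` nonzero sources have lobe offset `||n| − 8|p|| ≤ D`;
* `sum_levels_class_le`: the level weights `u = 1 / 2/5 / 1/9` (`|d| ≤ 24 / ≤ 56 / else`) have class sums `≤ 467/45`;
* **`classBound_of_blockMasses`**: a fibrewise mass bound `μ₀(n,p) ≤ φ(|n|)` on the tube yields the class bound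
  `Σ_{p∈S_n, p≡r} u(n,p)·μ₀(n,p) ≤ (467/45)·φ(|n|)` — the hypothesis `hΓ` of the frame.
No definitions; nothing about the crux. [cite: Grafakos2014, Prop. 3.1.2 (5), Prop. 3.2.7 (3)] [problem: turb]
-/

-- `Summit.<Summit>.<Problem>`: single-conjunct summit, the duplicate namespace segment is deliberate.
set_option linter.dupNamespace false

noncomputable section

namespace Summit.AnomalousDissipation.AnomalousDissipation.Theorems.SawtoothPulseCascade.K1Start

open MeasureTheory Filter Topology UnitAddTorus Complex AddCircle
open scoped Real
open Literature.Analysis Literature.Analysis.FunctionSpaces Literature.Analysis.FunctionSpaces.Torus Literature.Analysis.FluidPDE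
open Literature.Analysis.FluidPDE.ShearStage
open Literature.Analysis.FluidPDE.SawtoothCascade Literature.Analysis.FluidPDE.SawtoothCascade.CascadeParams
open Summit.AnomalousDissipation.AnomalousDissipation.Theorems.SawtoothPulseCascade.K1Window

/-! ## §1 The V-twist window mass on a block of fibres -/

/-- **V-TWIST WINDOW MASS ON A BLOCK**: `120 ≤ N_a ≤ |n| ≤ N_b`, `p ∈ S_n`, `K` with the shifted window inside `|m′| ≤ 4K − 2`
(`W_b + (N_b+399)/8 + 2 ≤ 4K`, `W_b = 799` if `N_b < 200` else `4N_b`), `4K < 8N_a`, and slacks `s_a, s_b ≥ 0` with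
`1/(8N_a−4K) − 1/(8N_a) ≤ s_a²`, `1/(8N_a) − 1/(8N_a+4K) ≤ s_b²`:
`Σ_{|m| ≤ W(n)} ‖ĝ₀ⁿ(m−p)‖² ≤ 2·0.101322·(s_a+s_b)²`. [cite: Grafakos2014, Prop. 3.1.2 (5), Prop. 3.2.7 (3)] -/
theorem vtwist_window_mass_le {Na Nb K : ℕ} {sa sb : ℝ} (hNa : 120 ≤ Na) {n p : ℤ} (hn1 : (Na : ℤ) ≤ |n|) (hn2 : |n| ≤ Nb)
    (hp : p ∈ (Finset.Icc (-400 : ℤ) 400).filter (fun p => |(8 * |p| - |n|)| < 400))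
    (hWK : (if Nb < 200 then (799 : ℤ) else 4 * Nb) + ((Nb : ℤ) + 399) / 8 + 2 ≤ 4 * K) (hK : 4 * (K : ℝ) < 8 * Na)
    (hsa : 0 ≤ sa) (hsb : 0 ≤ sb) (ha : 1 / (8 * (Na : ℝ) - 4 * K) - 1 / (8 * Na) ≤ sa ^ 2)
    (hb : 1 / (8 * (Na : ℝ)) - 1 / (8 * Na + 4 * K) ≤ sb ^ 2) :
    ∑ m ∈ Finset.Icc (-(if |n| < 200 then (799 : ℤ) else 4 * |n|)) (if |n| < 200 then (799 : ℤ) else 4 * |n|),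
        ‖fourierCoeff ((periodic_exactChirpFun 2 (8 * n)).lift) (m - p)‖ ^ 2 ≤ 2 * 0.101322 * (sa + sb) ^ 2 := by
  classical
  have hπ : 0 < π := Real.pi_pos
  obtain ⟨hg₀c, hg₀⟩ := continuous_exactChirp_lift 2 (8 * n)
  rw [Finset.mem_filter, Finset.mem_Icc] at hp
  -- reindex `m' = m − p`
  set W : ℤ := if |n| < 200 then (799 : ℤ) else 4 * |n| with hWdef
  rw [← Finset.sum_image (s := Finset.Icc (-W) W) (g := fun m => m - p) (f := fun m' => ‖fourierCoeff _ m'‖ ^ 2)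
    (fun a _ b _ h => by simpa using h)]
  set W' := (Finset.Icc (-W) W).image (fun m => m - p) with hW'
  -- every `m' ∈ W'` has `|m'| ≤ 4K − 2 < 8|n|`
  have hbound : ∀ m' ∈ W', |m'| ≤ 4 * (K : ℤ) - 2 := by
    intro m' hm'
    rw [hW', Finset.mem_image] at hm'
    obtain ⟨m, hm, rfl⟩ := hm'
    rw [Finset.mem_Icc] at hm
    have h1 := abs_choice n; have h2 := abs_choice p; have h3 := abs_choice (8 * |p| - |n|); have h4 := abs_choice (m - p)
    have := abs_nonneg n; have := abs_nonneg p; have := abs_nonneg (8 * |p| - |n|); have := abs_nonneg (m - p)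
    have hn2' : |n| ≤ (Nb : ℤ) := hn2
    simp only [hWdef] at hm
    split_ifs at hm hWK <;> omega
  have h4K : 4 * (K : ℤ) < 8 * (Na : ℤ) := by exact_mod_cast hK
  have hK8 : 4 * (K : ℤ) - 2 < 8 * |n| := by omega
  -- drop the zero terms (parity), split by sign
  set f : ℤ → ℝ := fun m' => ‖fourierCoeff ((periodic_exactChirpFun 2 (8 * n)).lift) m'‖ ^ 2 with hf
  have hne : ∀ m' ∈ W', 8 * n + m' ≠ 0 ∧ 8 * n - m' ≠ 0 := by
    intro m' hm'
    have hb' := hbound m' hm'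
    have h1 := abs_choice n; have h4 := abs_choice m'; have := abs_nonneg n; have := abs_nonneg m'
    constructor <;> omega
  have hzero : ∀ m' ∈ W', m' ∉ W'.filter (fun m => m % 4 = 2) → f m' = 0 := by
    intro m' hm' hnot
    rw [Finset.mem_filter, not_and] at hnot
    simp only [hf]
    rw [fourierCoeff_twoTooth_eq_zero_of_mod_ne n hg₀ (hne m' hm').1 (hne m' hm').2 (hnot hm'), norm_zero, zero_pow two_ne_zero]
  have h1 : ∑ m' ∈ W', f m' = ∑ m' ∈ W'.filter (fun m => m % 4 = 2), f m' :=
    (Finset.sum_subset (Finset.filter_subset _ W') hzero).symm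
  rw [h1, ← Finset.sum_filter_add_sum_filter_not (W'.filter (fun m => m % 4 = 2)) (fun m => 0 ≤ m)]
  have hc : (0 : ℝ) < Na := by
    have : (120 : ℝ) ≤ Na := by exact_mod_cast hNa
    linarith
  have hcn : (Na : ℝ) ≤ |(n : ℝ)| := by exact_mod_cast hn1
  have hK' : 4 * (K : ℝ) < 8 * (Na : ℝ) := hK
  have ha' : 1 / (8 * (Na : ℝ) - 4 * K) - 1 / (8 * (Na : ℝ) - 4 * (0 : ℕ)) ≤ sa ^ 2 := by simpa using ha
  have hb' : 1 / (8 * (Na : ℝ) + 4 * (0 : ℕ)) - 1 / (8 * (Na : ℝ) + 4 * K) ≤ sb ^ 2 := by simpa using hb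
  have hpos := sum_window_sq_norm_twoTooth_inside_pos_le n hg₀ hc hcn (Nat.zero_le K) hK' hsa hsb ha' hb'
    ((W'.filter (fun m => m % 4 = 2)).filter (fun m => 0 ≤ m)) (fun m hm => by
      rw [Finset.mem_filter, Finset.mem_filter] at hm
      have := hbound m hm.1.1; have := abs_choice m; have := abs_nonneg m
      push_cast; constructor <;> omega)
  have hneg := sum_window_sq_norm_twoTooth_inside_neg_le n hg₀ hc hcn (Nat.zero_le K) hK' hsa hsb ha' hb'
    ((W'.filter (fun m => m % 4 = 2)).filter (fun m => ¬ 0 ≤ m)) (fun m hm => by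
      rw [Finset.mem_filter, Finset.mem_filter] at hm
      have := hbound m hm.1.1; have := abs_choice m; have := abs_nonneg m
      push_cast; constructor <;> omega)
  have hpi := inv_pi_sq_le
  have hsq : 0 ≤ (sa + sb) ^ 2 := sq_nonneg _
  simp only [hf] at hpos hneg ⊢
  nlinarith [hpos, hneg, hpi, hsq]

/-! ## §2 The explicit antitone majorant `φ` and the level weights -/

/-- **`φ` is antitone on `x ≥ 120`**: for `120 ≤ x ≤ y`, `φ(y) ≤ φ(x)` where
`φ(x) = [x < 200]·0.0396607/(x − 108.5) + [x ≥ 200]·0.0768758/(x − 22)`. [folklore] -/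
theorem phiV_antitone {x y : ℝ} (hx : 120 ≤ x) (hxy : x ≤ y) :
    (if y < 200 then 0.0396607 / (y - 108.5) else 0.0768758 / (y - 22) : ℝ) ≤
      (if x < 200 then 0.0396607 / (x - 108.5) else 0.0768758 / (x - 22)) := by
  split_ifs with hy hx2 hx2
  · exact div_le_div_of_nonneg_left (by norm_num) (by linarith) (by linarith)
  · linarith
  · -- `x < 200 ≤ y`: `φ₂(y) ≤ φ₂(200) ≤ φ₁(200⁻) ≤ φ₁(x)`
    calc (0.0768758 : ℝ) / (y - 22) ≤ 0.0768758 / (200 - 22) := div_le_div_of_nonneg_left (by norm_num) (by norm_num) (by linarith)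
      _ ≤ 0.0396607 / (200 - 108.5) := by norm_num
      _ ≤ 0.0396607 / (x - 108.5) := div_le_div_of_nonneg_left (by norm_num) (by linarith) (by linarith)
  · exact div_le_div_of_nonneg_left (by norm_num) (by linarith) (by linarith)

/-- `φ > 0` on `x ≥ 120`. [folklore] -/
theorem phiV_pos {x : ℝ} (hx : 120 ≤ x) : 0 < (if x < 200 then 0.0396607 / (x - 108.5) else 0.0768758 / (x - 22) : ℝ) := by
  split_ifs <;> exact div_pos (by norm_num) (by linarith)

/-- **Sources of one class in a lobe-offset window are few**: for any `n, r` and `D : ℕ`,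
`#{p ∈ [−400,400] : p ≠ 0, p ≡ r (mod 4), ||n| − 8|p|| ≤ D} ≤ 2(⌊D/16⌋ + 1)` (the values `8|p|` of one class and one sign form a
progression of step `32` inside an interval of length `2D`). [folklore] -/
theorem card_tube_class_le (n r : ℤ) (D : ℕ) :
    ((Finset.Icc (-400 : ℤ) 400).filter (fun p => p ≠ 0 ∧ p % 4 = r ∧ |(|n| - 8 * |p|)| ≤ D)).card ≤ 2 * (D / 16 + 1) := by
  classical
  set T : Finset (ℤ × Bool) := (Finset.Icc (0 : ℤ) (D / 16)) ×ˢ (Finset.univ : Finset Bool) with hT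
  have hTcard : T.card = 2 * (D / 16 + 1) := by
    rw [hT, Finset.card_product, Int.card_Icc, Finset.card_univ, Fintype.card_bool]
    have : ((D : ℤ) / 16 + 1 - 0).toNat = D / 16 + 1 := by omega
    rw [this]; ring
  rw [← hTcard]
  refine Finset.card_le_card_of_injOn (fun p => ((8 * |p| - |n| + D) / 32, decide (0 < p))) (fun p hp => ?_) ?_
  · rw [Finset.mem_coe, Finset.mem_filter, Finset.mem_Icc] at hp
    rw [Finset.mem_coe, hT, Finset.mem_product, Finset.mem_Icc]
    dsimp only
    have h1 := abs_choice n; have h2 := abs_choice p; have h3 := abs_choice (|n| - 8 * |p|)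
    have := abs_nonneg n; have := abs_nonneg p; have := abs_nonneg (|n| - 8 * |p|)
    refine ⟨⟨by omega, by omega⟩, Finset.mem_univ _⟩
  · intro p hp p' hp' h
    rw [Finset.mem_coe, Finset.mem_filter, Finset.mem_Icc] at hp hp'
    simp only [Prod.mk.injEq, decide_eq_decide] at h
    have h1 := abs_choice n; have h2 := abs_choice p; have h2' := abs_choice p'
    have h3 := abs_choice (|n| - 8 * |p|); have h3' := abs_choice (|n| - 8 * |p'|)
    have := abs_nonneg n; have := abs_nonneg p; have := abs_nonneg p'; have := abs_nonneg (|n| - 8 * |p|)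
    have := abs_nonneg (|n| - 8 * |p'|)
    omega

/-- **Class sums of the level weights**: for `120 ≤ |n|` and every class `r`,
`Σ_{p∈S_n, p≡r} u(n,p) ≤ 467/45`, `u = 1, 2/5, 1/9` on `||n|−8|p|| ≤ 24`, `≤ 56`, otherwise. [folklore] -/
theorem sum_levels_class_le {n : ℤ} (hn : 120 ≤ |n|) (r : ℤ) :
    ∑ p ∈ ((Finset.Icc (-400 : ℤ) 400).filter (fun p => |(8 * |p| - |n|)| < 400)).filter (fun p => p % 4 = r),
      (if |(|n| - 8 * |p|)| ≤ 24 then (1 : ℝ) else if |(|n| - 8 * |p|)| ≤ 56 then 2 / 5 else 1 / 9) ≤ 467 / 45 := by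
  classical
  set S := ((Finset.Icc (-400 : ℤ) 400).filter (fun p => |(8 * |p| - |n|)| < 400)).filter (fun p => p % 4 = r) with hS
  -- `u = 1/9 + 13/45·[≤56] + 3/5·[≤24]`
  have hu : ∀ p : ℤ, (if |(|n| - 8 * |p|)| ≤ 24 then (1 : ℝ) else if |(|n| - 8 * |p|)| ≤ 56 then 2 / 5 else 1 / 9) =
      1 / 9 + (13 / 45) * (if |(|n| - 8 * |p|)| ≤ 56 then (1 : ℝ) else 0) + (3 / 5) * (if |(|n| - 8 * |p|)| ≤ 24 then (1 : ℝ) else 0) := by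
    intro p
    by_cases h24 : |(|n| - 8 * |p|)| ≤ 24
    · have h56 : |(|n| - 8 * |p|)| ≤ 56 := by omega
      rw [if_pos h24, if_pos h56, if_pos h24]; norm_num
    · rw [if_neg h24, if_neg h24]
      split_ifs <;> norm_num
  simp_rw [hu]
  rw [Finset.sum_add_distrib, Finset.sum_add_distrib, Finset.sum_const, ← Finset.mul_sum, ← Finset.mul_sum,
    Finset.sum_boole, Finset.sum_boole, nsmul_eq_mul]
  -- the three cardinalities
  have hsub : ∀ D : ℕ, (S.filter (fun p => |(|n| - 8 * |p|)| ≤ D)) ⊆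
      insert 0 ((Finset.Icc (-400 : ℤ) 400).filter (fun p => p ≠ 0 ∧ p % 4 = r ∧ |(|n| - 8 * |p|)| ≤ D)) := by
    intro D p hp
    rw [hS, Finset.mem_filter, Finset.mem_filter, Finset.mem_filter] at hp
    rw [Finset.mem_insert, Finset.mem_filter]
    by_cases h0 : p = 0
    · exact Or.inl h0
    · exact Or.inr ⟨hp.1.1.1, h0, hp.1.2, hp.2⟩
  have hcardD : ∀ D : ℕ, (S.filter (fun p => |(|n| - 8 * |p|)| ≤ D)).card ≤ 2 * (D / 16 + 1) + 1 := fun D =>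
    ((Finset.card_le_card (hsub D)).trans (Finset.card_insert_le _ _)).trans (by have := card_tube_class_le n r D; omega)
  -- no zero source when `D < |n|`: sharper count for `D = 24, 56`
  have hcardD' : ∀ D : ℕ, (D : ℤ) < |n| → (S.filter (fun p => |(|n| - 8 * |p|)| ≤ D)).card ≤ 2 * (D / 16 + 1) := by
    intro D hD
    have hsub' : (S.filter (fun p => |(|n| - 8 * |p|)| ≤ D)) ⊆
        ((Finset.Icc (-400 : ℤ) 400).filter (fun p => p ≠ 0 ∧ p % 4 = r ∧ |(|n| - 8 * |p|)| ≤ D)) := by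
      intro p hp
      rw [hS, Finset.mem_filter, Finset.mem_filter, Finset.mem_filter] at hp
      rw [Finset.mem_filter]
      have h0 : p ≠ 0 := by
        rintro rfl
        have := hp.2; simp only [abs_zero, mul_zero, sub_zero, abs_abs] at this; omega
      exact ⟨hp.1.1.1, h0, hp.1.2, hp.2⟩
    exact (Finset.card_le_card hsub').trans (card_tube_class_le n r D)
  have hS' : S.card ≤ 51 := by
    have e : S.filter (fun p => |(|n| - 8 * |p|)| ≤ ((399 : ℕ) : ℤ)) = S := by
      refine Finset.filter_true_of_mem fun p hp => ?_
      rw [hS, Finset.mem_filter, Finset.mem_filter] at hp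
      have := hp.1.2
      have h1 := abs_choice (8 * |p| - |n|); have h2 := abs_choice (|n| - 8 * |p|)
      have := abs_nonneg (8 * |p| - |n|); have := abs_nonneg (|n| - 8 * |p|); push_cast; omega
    have := hcardD 399
    rw [e] at this; omega
  have h56 : (S.filter (fun p => |(|n| - 8 * |p|)| ≤ ((56 : ℕ) : ℤ))).card ≤ 8 := (hcardD' 56 (by omega)).trans (by norm_num)
  have h24 : (S.filter (fun p => |(|n| - 8 * |p|)| ≤ ((24 : ℕ) : ℤ))).card ≤ 4 := (hcardD' 24 (by omega)).trans (by norm_num)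
  push_cast at h56 h24
  have hS'r : (S.card : ℝ) ≤ 51 := by exact_mod_cast hS'
  have h56r : ((S.filter (fun p => |(|n| - 8 * |p|)| ≤ 56)).card : ℝ) ≤ 8 := by exact_mod_cast h56
  have h24r : ((S.filter (fun p => |(|n| - 8 * |p|)| ≤ 24)).card : ℝ) ≤ 4 := by exact_mod_cast h24
  linarith

/-! ## §3 The class bound `Γ` from fibrewise masses -/

/-- **THE CLASS BOUND FROM BLOCK MASSES**: if every tube source has window mass `μ₀(n,p) ≤ φ(|n|)` (`n ∈ B`), then for every class `r`,
`Σ_{p∈S_n, p≡r} u(n,p)·μ₀(n,p) ≤ (467/45)·φ(|n|)` with the level weights `u` of `sum_levels_class_le`. [cite: Grafakos2014, Prop. 3.2.7 (3)] -/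
theorem classBound_of_blockMasses
    (hM : ∀ n ∈ (Finset.Icc (-3600 : ℤ) 3600).filter (fun n => 120 ≤ |n|),
      ∀ p ∈ (Finset.Icc (-400 : ℤ) 400).filter (fun p => |(8 * |p| - |n|)| < 400),
        ∑ m ∈ Finset.Icc (-(if |n| < 200 then (799 : ℤ) else 4 * |n|)) (if |n| < 200 then (799 : ℤ) else 4 * |n|),
          ‖fourierCoeff ((periodic_exactChirpFun 2 (8 * n)).lift) (m - p)‖ ^ 2 ≤
          (if (|n| : ℝ) < 200 then 0.0396607 / ((|n| : ℝ) - 108.5) else 0.0768758 / ((|n| : ℝ) - 22)))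
    (n : ℤ) (hn : n ∈ (Finset.Icc (-3600 : ℤ) 3600).filter (fun n => 120 ≤ |n|)) (r : ℤ) (_hr : r ∈ Finset.Icc (0 : ℤ) 3) :
    ∑ p ∈ ((Finset.Icc (-400 : ℤ) 400).filter (fun p => |(8 * |p| - |n|)| < 400)).filter (fun p => p % 4 = r),
      (if |(|n| - 8 * |p|)| ≤ 24 then (1 : ℝ) else if |(|n| - 8 * |p|)| ≤ 56 then 2 / 5 else 1 / 9) *
        ∑ m ∈ Finset.Icc (-(if |n| < 200 then (799 : ℤ) else 4 * |n|)) (if |n| < 200 then (799 : ℤ) else 4 * |n|),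
          ‖fourierCoeff ((periodic_exactChirpFun 2 (8 * n)).lift) (m - p)‖ ^ 2 ≤
      467 / 45 * (if (|n| : ℝ) < 200 then 0.0396607 / ((|n| : ℝ) - 108.5) else 0.0768758 / ((|n| : ℝ) - 22)) := by
  have hn120 : 120 ≤ |n| := (Finset.mem_filter.1 hn).2
  have hφ0 : 0 ≤ (if (|n| : ℝ) < 200 then 0.0396607 / ((|n| : ℝ) - 108.5) else 0.0768758 / ((|n| : ℝ) - 22) : ℝ) := by
    have : (120 : ℝ) ≤ (|n| : ℝ) := by exact_mod_cast hn120
    exact (phiV_pos this).le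
  have hu0 : ∀ p : ℤ, 0 ≤ (if |(|n| - 8 * |p|)| ≤ 24 then (1 : ℝ) else if |(|n| - 8 * |p|)| ≤ 56 then 2 / 5 else 1 / 9) :=
    fun p => by split_ifs <;> norm_num
  calc ∑ p ∈ ((Finset.Icc (-400 : ℤ) 400).filter (fun p => |(8 * |p| - |n|)| < 400)).filter (fun p => p % 4 = r),
        (if |(|n| - 8 * |p|)| ≤ 24 then (1 : ℝ) else if |(|n| - 8 * |p|)| ≤ 56 then 2 / 5 else 1 / 9) *
          ∑ m ∈ Finset.Icc (-(if |n| < 200 then (799 : ℤ) else 4 * |n|)) (if |n| < 200 then (799 : ℤ) else 4 * |n|),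
            ‖fourierCoeff ((periodic_exactChirpFun 2 (8 * n)).lift) (m - p)‖ ^ 2
      ≤ ∑ p ∈ ((Finset.Icc (-400 : ℤ) 400).filter (fun p => |(8 * |p| - |n|)| < 400)).filter (fun p => p % 4 = r),
          (if |(|n| - 8 * |p|)| ≤ 24 then (1 : ℝ) else if |(|n| - 8 * |p|)| ≤ 56 then 2 / 5 else 1 / 9) *
            (if (|n| : ℝ) < 200 then 0.0396607 / ((|n| : ℝ) - 108.5) else 0.0768758 / ((|n| : ℝ) - 22)) :=
        Finset.sum_le_sum fun p hp => mul_le_mul_of_nonneg_left (hM n hn p (Finset.mem_filter.1 hp).1) (hu0 p)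
    _ = (∑ p ∈ ((Finset.Icc (-400 : ℤ) 400).filter (fun p => |(8 * |p| - |n|)| < 400)).filter (fun p => p % 4 = r),
          (if |(|n| - 8 * |p|)| ≤ 24 then (1 : ℝ) else if |(|n| - 8 * |p|)| ≤ 56 then 2 / 5 else 1 / 9)) *
            (if (|n| : ℝ) < 200 then 0.0396607 / ((|n| : ℝ) - 108.5) else 0.0768758 / ((|n| : ℝ) - 22)) := by
        rw [Finset.sum_mul]
    _ ≤ 467 / 45 * _ := mul_le_mul_of_nonneg_right (sum_levels_class_le hn120 r) hφ0

end Summit.AnomalousDissipation.AnomalousDissipation.Theorems.SawtoothPulseCascade.K1Start
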